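import Summits.ResolutionOfSingularities.ResolutionOfSingularities.Theorems.NarrowRunsDie.Negative.FuelFamilyNarrow

/-!
# `NarrowRunsDie` (crux stmt-ResolutionOfSingularities-16882, route `WildCones`):
# NO UNIFORM BOUND — isolated narrow runs of every finite length exist (tightness)
(negative-side support for crux stmt-ResolutionOfSingularities-16882, refuter crux-disprover seat; this file
does NOT refute the crux)

`WildCones.NarrowRunsDie` forbids INFINITE runs all of whose states are `Isol ∧ MultP` and
`OrdP ∧ dL = 1`. Here, sorry-free and kernel-checked against the VERBATIM `let` calculus, its
natural quantitative strengthening is refuted: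

* `narrowRunsDie_no_uniform_bound` — there is NO `N` such that every run already fails
  `(Isol ∧ MultP) ∧ (OrdP ∧ dL = 1)` at some stage `m ≤ N`. Witness for a given `N`: `p = 3`,
  `n = 3`, `κ = 𝔽₃`, start `a_(2N+3)` of the fuel family `a_k = u₀²u₁ + u₁³u₂ + u₀u₂^k`
  (`Negative/FuelFamilyRun.lean`, `Negative/FuelFamilyNarrow.lean`), chart word `≡ 2`, translation
  word `≡ 0`: stage `m ≤ N` is `a_(2N+3-2m)` with `2N+3-2m ≥ 3`, which is isolated, of cleaned
  order exactly `3`, with `dL = 1` (forced direction `e₂` — the run IS the forced one; it dies at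
  stage `N + 1` where `u₀u₂` has degree `2`).

Consequences for the lead / provers: (i) the crux hypotheses are jointly satisfiable on every finite
prefix (the statement is not cheaply true); (ii) any termination argument must produce a bound
depending on the start state — as the `derivlift` line's `D + 2` (`D` = `u_(i 0)`-nilpotency index
of `κ[[u]]/(∂a₀)`; here `D` grows like `2k`) does; (iii) the first kernel-certified ISOLATED states
of the calculus, with a reusable certificate (`Negative/JacobianQuotientFinite.lean`).
-/

noncomputable section

set_option linter.dupNamespace false

namespace Summit.ResolutionOfSingularities.ResolutionOfSingularities.Theorems.NarrowRunsDie.Negative.Family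

/-! ## The headline negative lemma: no uniform bound on the length of narrow isolated runs -/

/-- **No uniform bound.** The natural quantitative strengthening of `WildCones.NarrowRunsDie` —
"there is `N` such that NO run of the dynamics is isolated of multiplicity `p`, of cleaned order
exactly `p` and with `dL = 1` at every stage `m ≤ N`" (crux calculus VERBATIM, same binders
`p` odd prime, `3 ≤ n`, `κ` perfect of characteristic `p`) — is FALSE: over `𝔽₃` with `n = 3`,
the state `a_k = u₀²u₁ + u₁³u₂ + u₀u₂^k` with `k = 2N + 3`, chart word `≡ 2`, translation word
`≡ 0`, runs through `a_{2N+3}, a_{2N+1}, …, a_3` at stages `0, …, N`, and every `a_k` with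
`k ≥ 3` is isolated (`(∂a_k) ∋ X₀², X₁⁶, X₂^{2k}`, Milnor-type number `6k`), cleaned of order
exactly `3` with cone `u₀²u₁` and `Linv = {w₀ = w₁ = 0}` (`dL = 1`, forced direction `e₂` — the
run IS the forced one). So narrow isolated runs of every finite length exist, the crux's
hypotheses are jointly satisfiable on every finite prefix, and any termination bound must depend
on the start state (as the `derivlift` line's `D + 2`, `D` the `u_{i 0}`-nilpotency index, does).
This does NOT refute the crux. [folklore] -/
theorem narrowRunsDie_no_uniform_bound :
    ¬ (∃ N : ℕ, ∀ p : ℕ, p.Prime → p ≠ 2 → ∀ n : ℕ, 3 ≤ n → ∀ (κ : Type) [Field κ] [CharP κ p] [PerfectField κ] (c₀ : (Fin n → ℕ) → κ) (i : ℕ → Fin n) (t : ℕ → Fin n → κ), let clean : ((Fin n → ℕ) → κ) → ((Fin n → ℕ) → κ) := fun c A => @ite κ (∀ j, p ∣ A j) (Classical.dec _) 0 (c A); let bl : Fin n → ((Fin n → ℕ) → κ) → ((Fin n → ℕ) → κ) := fun i c B => @ite κ (Finset.sum (Finset.univ.erase i) (fun j => B j) ≤ B i) (Classical.dec _) (c (Function.update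 B i (B i - Finset.sum (Finset.univ.erase i) (fun j => B j)))) 0; let ord : ((Fin n → ℕ) → κ) → ℕ := fun c => sInf {m : ℕ | ∃ A, c A ≠ 0 ∧ m = Finset.sum Finset.univ (fun j => A j)}; let dv : Fin n → ℕ → ((Fin n → ℕ) → κ) → ((Fin n → ℕ) → κ) := fun i s c B => c (Function.update B i (B i + s)); let tr : Fin n → (Fin n → κ) → ℕ → ((Fin n → ℕ) → κ) → ((Fin n → ℕ) → κ) := fun i τ s c B => Finset.sum (Fintype.piFinset (fun _ : Fin n => Finset.range (B i + s + 1))) (fun D => @ite κ (D i = 0) (Classical.dec _) (c (B + D) * Finset.prod (Finset.univ.erase i) (fun j => ((Nat.choose (B j + D j) (B j) : ℕ) : κ) * τ j ^ (D j))) 0); let step : Fin n → (Fin n → κ) → ((Fin n → ℕ) → κ) → ((Fin n → ℕ) → κ) := fun i τ c => clean (tr i τ (@ite ℕ (p ≤ ord (clean c)) (Classical.dec _) p 0) (dv i (@ite ℕ (p ≤ ord (clean c)) (Classical.dec _) p 0) (bl i (clean c)))); let run : ((Fin n → ℕ) → κ) → (ℕ → Fin n) → (ℕ → Fin n → κ)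 → ℕ → ((Fin n → ℕ) → κ) := fun c₀ i t m => @Nat.rec (fun _ => (Fin n → ℕ) → κ) c₀ (fun m c => step (i m) (t m) c) m; let ser : ((Fin n → ℕ) → κ) → MvPowerSeries (Fin n) κ := fun c => show MvPowerSeries (Fin n) κ from fun A : Fin n →₀ ℕ => clean c ⇑A; let pd : Fin n → MvPowerSeries (Fin n) κ → MvPowerSeries (Fin n) κ := fun i f => show MvPowerSeries (Fin n) κ from fun A : Fin n →₀ ℕ => ((A i + 1 : ℕ) : κ) * f (A + Finsupp.single i 1); let jac : ((Fin n → ℕ) → κ) → Ideal (MvPowerSeries (Fin n) κ) := fun c => Ideal.span (Set.range (fun i => pd i (ser c))); let Isol : ((Fin n → ℕ) → κ) → Prop := fun c => Module.Finite κ (MvPowerSeries (Fin n) κ ⧸ jac c); let MultP : ((Fin n → ℕ) → κ) → Prop := fun c => (∃ A, clean c A ≠ 0) ∧ ∀ A, clean c A ≠ 0 → p ≤ Finset.sum Finset.univ (fun j => A j); let OrdP : ((Fin n → ℕ) → κ) → Prop := fun c => ∃ A, clean c A ≠ 0 ∧ Finset.sum Finset.univ (fun j => A j) = p; let cone : ((Fin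 n → ℕ) → κ) → MvPolynomial (Fin n) κ := fun c => Finset.sum (Fintype.piFinset (fun _ : Fin n => Finset.range (p + 1))) (fun A => @ite (MvPolynomial (Fin n) κ) (Finset.sum Finset.univ (fun j => A j) = p) (Classical.dec _) (MvPolynomial.monomial (Finsupp.equivFunOnFinite.symm A) (clean c A)) 0); let Linv : ((Fin n → ℕ) → κ) → Set (Fin n → κ) := fun c => {w : Fin n → κ | MvPolynomial.aeval (fun j : Fin n => (MvPolynomial.X (some j) : MvPolynomial (Option (Fin n)) κ) + MvPolynomial.C (w j) * MvPolynomial.X none) (cone c) = MvPolynomial.rename some (cone c) + MvPolynomial.C (MvPolynomial.eval w (cone c)) * (MvPolynomial.X none) ^ p}; let dL : ((Fin n → ℕ) → κ) → ℕ := fun c => Module.finrank κ (Submodule.span κ (Linv c)); ¬ (∀ m, m ≤ N → (Isol (run c₀ i t m) ∧ MultP (run c₀ i t m)) ∧ (OrdP (run c₀ i t m) ∧ dL (run c₀ i t m) = 1))) := by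
  rintro ⟨N, h⟩
  have key : ∀ (cf : ℕ → (Fin 3 → ℕ) → ZMod 3), cf = (fun k =>
      (Pi.single (![2, 1, 0] : Fin 3 → ℕ) (1 : ZMod 3) : (Fin 3 → ℕ) → ZMod 3) +
        Pi.single (![0, 3, 1] : Fin 3 → ℕ) (1 : ZMod 3) + Pi.single (![1, 0, k] : Fin 3 → ℕ) (1 : ZMod 3)) →
      let clean : ((Fin 3 → ℕ) → (ZMod 3)) → ((Fin 3 → ℕ) → (ZMod 3)) := fun c A => @ite (ZMod 3) (∀ j, 3 ∣ A j) (Classical.dec _) 0 (c A); let bl : Fin 3 → ((Fin 3 → ℕ) → (ZMod 3)) → ((Fin 3 → ℕ) → (ZMod 3)) := fun i c B => @ite (ZMod 3) (Finset.sum (Finset.univ.erase i) (fun j => B j) ≤ B i) (Classical.dec _) (c (Function.update B i (B i - Finset.sum (Finset.univ.erase i) (fun j => B j)))) 0; let ord : ((Fin 3 → ℕ) → (ZMod 3)) → ℕ := fun c => sInf {m : ℕ | ∃ A, c A ≠ 0 ∧ m = Finset.sum Finset.univ (fun j => A j)}; let dv : Fin 3 → ℕ → ((Fin 3 → ℕ)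 → (ZMod 3)) → ((Fin 3 → ℕ) → (ZMod 3)) := fun i s c B => c (Function.update B i (B i + s)); let tr : Fin 3 → (Fin 3 → (ZMod 3)) → ℕ → ((Fin 3 → ℕ) → (ZMod 3)) → ((Fin 3 → ℕ) → (ZMod 3)) := fun i τ s c B => Finset.sum (Fintype.piFinset (fun _ : Fin 3 => Finset.range (B i + s + 1))) (fun D => @ite (ZMod 3) (D i = 0) (Classical.dec _) (c (B + D) * Finset.prod (Finset.univ.erase i) (fun j => ((Nat.choose (B j + D j) (B j) : ℕ) : (ZMod 3)) * τ j ^ (D j))) 0); let step : Fin 3 → (Fin 3 → (ZMod 3)) → ((Fin 3 → ℕ) → (ZMod 3)) → ((Fin 3 → ℕ) → (ZMod 3)) := fun i τ c => clean (tr i τ (@ite ℕ (3 ≤ ord (clean c)) (Classical.dec _) 3 0) (dv i (@ite ℕ (3 ≤ ord (clean c)) (Classical.dec _) 3 0) (bl i (clean c)))); let run : ((Fin 3 → ℕ) → (ZMod 3)) → (ℕ → Fin 3) → (ℕ → Fin 3 → (ZMod 3)) → ℕ → ((Fin 3 → ℕ) → (ZMod 3)) := fun c₀ i t m => @Nat.rec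 (fun _ => (Fin 3 → ℕ) → (ZMod 3)) c₀ (fun m c => step (i m) (t m) c) m; let ser : ((Fin 3 → ℕ) → (ZMod 3)) → MvPowerSeries (Fin 3) (ZMod 3) := fun c => show MvPowerSeries (Fin 3) (ZMod 3) from fun A : Fin 3 →₀ ℕ => clean c ⇑A; let pd : Fin 3 → MvPowerSeries (Fin 3) (ZMod 3) → MvPowerSeries (Fin 3) (ZMod 3) := fun i f => show MvPowerSeries (Fin 3) (ZMod 3) from fun A : Fin 3 →₀ ℕ => ((A i + 1 : ℕ) : (ZMod 3)) * f (A + Finsupp.single i 1); let jac : ((Fin 3 → ℕ) → (ZMod 3)) → Ideal (MvPowerSeries (Fin 3) (ZMod 3)) := fun c => Ideal.span (Set.range (fun i => pd i (ser c))); let Isol : ((Fin 3 → ℕ) → (ZMod 3)) → Prop := fun c => Module.Finite (ZMod 3) (MvPowerSeries (Fin 3) (ZMod 3) ⧸ jac c); let MultP : ((Fin 3 → ℕ) → (ZMod 3)) → Prop := fun c => (∃ A, clean c A ≠ 0) ∧ ∀ A, clean c A ≠ 0 → 3 ≤ Finset.sum Finset.univ (fun j => A j); let OrdP : ((Fin 3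 → ℕ) → (ZMod 3)) → Prop := fun c => ∃ A, clean c A ≠ 0 ∧ Finset.sum Finset.univ (fun j => A j) = 3; let cone : ((Fin 3 → ℕ) → (ZMod 3)) → MvPolynomial (Fin 3) (ZMod 3) := fun c => Finset.sum (Fintype.piFinset (fun _ : Fin 3 => Finset.range (3 + 1))) (fun A => @ite (MvPolynomial (Fin 3) (ZMod 3)) (Finset.sum Finset.univ (fun j => A j) = 3) (Classical.dec _) (MvPolynomial.monomial (Finsupp.equivFunOnFinite.symm A) (clean c A)) 0); let Linv : ((Fin 3 → ℕ) → (ZMod 3)) → Set (Fin 3 → (ZMod 3)) := fun c => {w : Fin 3 → (ZMod 3) | MvPolynomial.aeval (fun j : Fin 3 => (MvPolynomial.X (some j) : MvPolynomial (Option (Fin 3)) (ZMod 3)) + MvPolynomial.C (w j) * MvPolynomial.X none) (cone c) = MvPolynomial.rename some (cone c) + MvPolynomial.C (MvPolynomial.eval w (cone c)) * (MvPolynomial.X none) ^ 3}; let dL : ((Fin 3 → ℕ) → (ZMod 3)) → ℕ := fun c => Module.finrank (ZMod 3) (Submodule.span (ZMod 3) (Linv c)); ∀ m, m ≤ N → (Isol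 (run (cf (2 * N + 3)) (fun _ => 2) (fun _ _ => 0) m) ∧ MultP (run (cf (2 * N + 3)) (fun _ => 2) (fun _ _ => 0) m)) ∧ (OrdP (run (cf (2 * N + 3)) (fun _ => 2) (fun _ _ => 0) m) ∧ dL (run (cf (2 * N + 3)) (fun _ => 2) (fun _ _ => 0) m) = 1) := by
    intro cf hcf clean bl ord dv tr step run ser pd jac Isol MultP OrdP cone Linv dL m hm
    have hr : run (cf (2 * N + 3)) (fun _ => 2) (fun _ _ => 0) m = cf (2 * N + 3 - 2 * m) :=
      run_cf clean rfl bl rfl ord rfl dv rfl tr rfl step rfl run rfl cf hcf N m (by omega)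
    have hk3 : 3 ≤ 2 * N + 3 - 2 * m := by omega
    refine ⟨⟨?_, ?_⟩, ?_, ?_⟩
    · show Module.Finite (ZMod 3) (MvPowerSeries (Fin 3) (ZMod 3) ⧸ jac (run (cf (2 * N + 3)) (fun _ => 2) (fun _ _ => 0) m))
      rw [hr]
      exact isol_cf clean rfl ser rfl pd rfl jac rfl cf hcf _ (by omega)
    · show (∃ A, clean (run (cf (2 * N + 3)) (fun _ => 2) (fun _ _ => 0) m) A ≠ 0) ∧
        ∀ A, clean (run (cf (2 * N + 3)) (fun _ => 2) (fun _ _ => 0) m) A ≠ 0 →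
          3 ≤ Finset.sum Finset.univ (fun j => A j)
      rw [hr]
      exact multP_cf clean rfl cf hcf _ (by omega)
    · show ∃ A, clean (run (cf (2 * N + 3)) (fun _ => 2) (fun _ _ => 0) m) A ≠ 0 ∧
        Finset.sum Finset.univ (fun j => A j) = 3
      rw [hr]
      exact ordP_cf clean rfl cf hcf _
    · show dL (run (cf (2 * N + 3)) (fun _ => 2) (fun _ _ => 0) m) = 1
      rw [hr]
      exact dL_cf clean rfl cone rfl Linv rfl dL rfl cf hcf _ hk3
  exact h 3 Nat.prime_three (by decide) 3 le_rfl (ZMod 3) _ (fun _ => 2) (fun _ _ => 0) (key _ rfl)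


end Summit.ResolutionOfSingularities.ResolutionOfSingularities.Theorems.NarrowRunsDie.Negative.Family

end
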